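import Literature.NumberTheory.EllipticCurves.TateModuleGaloisTransportProofs
import Literature.NumberTheory.EllipticCurves.TwoAdicImageSurjectivityProofs
import Literature.NumberTheory.EllipticCurves.BSDSelmerPConverseSerreProofs
import Literature.NumberTheory.GaloisRepresentations.ModNCyclotomicCharacter
import Summits.BirchSwinnertonDyer.BirchSwinnertonDyer.Theorems.UniversalToricDescentLevelNineSaturation
import HarnessLib

/-!
# Galois image of an index-two subgroup on `E[pⁿ]`: transport to `E_L`, the odd-power tower lemma,
# and level `3` (`GL₂(𝔽₃)` is generated by its squares and one matrix of determinant `-1`)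

Route `UniversalToricDescent` (BirchSwinnertonDyer), `--supports` crux stmt-BirchSwinnertonDyer-23594
`TwinSplitIMCAtThreeGoodSSApZero` (the `a₃ = 0` re-key of 20695 `TwinSplitIMCAtThreeGoodSS`; also
20694 `TwinSplitIMCAtThreeMult`). Namespace
`Summit.BirchSwinnertonDyer.BirchSwinnertonDyer.Theorems.ThreeAdicImageOverK`. THEOREMS ONLY (no
definition, no named fact). Route-free group/Galois theory
used by the sequel `UniversalToricDescentTwinThreeAdicImageOverK.lean`, which proves the `p = 3` IMAGE
INPUT of the `⊇`-port (Howard 2004 Thm. B / Castella–Wan 2024 Thm. 5.12: «`Gal(K̄/K) → Aut_{ℤ_p}(T)`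
surjective») for every twin of the UTD cell and every quadratic `K` with `3 ∤ d_K`.

WHAT IS HERE (all fields general).
* §1 `hasSurjectiveModNGaloisRep_baseChange_of_forall_exists` — TRANSPORT: for `L/K` algebraic and
  `E/K` with `ρ̄_{E,n} : Γ_K → Aut(E[n])` onto, if every `γ ∈ Γ_K` agrees on `E[n]` with the
  restriction of some `δ ∈ Γ_L`, then `ρ̄_{E_L,n} : Γ_L → Aut(E_L[n])` is onto (the tree's equivariant
  `E(K̄) ≃ E_L(L̄)`, `WeierstrassCurve.exists_addEquiv_geomPoints_baseChange`).
* §2 `pow_smul_eq_self_of_smul_eq_self`, `pow_pow_smul_eq_self_of_smul_eq_self` — the ELEMENTARY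
  TOWER LEMMA: if `σ` fixes `E[m]` pointwise and `p ∣ m` then `σ^p` fixes `E[pm]` (write
  `σP = P + R` with `pR = 0`, so `R ∈ E[p] ⊆ E[m]` is fixed and `σ^j P = P + jR`); hence `σ ≡ 1` on
  `E[p]` ⟹ `σ^{p^k} ≡ 1` on `E[p^{k+1}]` ("the level-`p` congruence kernel is pro-`p`", on points).
* §3 `forall_exists_mem_smul_eq_pow` — INDEX-TWO ASSEMBLY: `H ≤ Γ_F` containing every square,
  `p` ODD; if `H` meets every class of `Γ_F` modulo the pointwise fixer of `E[p]`, it meets every class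
  modulo the fixer of `E[pⁿ]` (`γ = h₁ν` with `ν ≡ 1` on `E[p]`; `ν^{p^{n-1}} ≡ 1` on `E[pⁿ]` and
  `p^{n-1} = 2m+1`, so `ν ≡ (ν^m ν^m)⁻¹` on `E[pⁿ]`, an element of `H`).
* §4 `generalLinearGroup_three_eq_top_of_sq_mem` — a subgroup of `GL₂(𝔽₃)` containing all squares
  and one element of determinant `≠ 1` is everything (`(1 x; 0 1) = (1 2x; 0 1)²`, `(1 0; c 1)`,
  `-1 = (0 1; 2 0)²`, and `LevelNine.sl_two_factor_of_ne_zero`); whence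
  `forall_exists_mem_smul_eq_three`: for `E/F` (`F` perfect, `3 ≠ 0`) with `ρ̄_{E,3}` onto and
  `H ≤ Γ_F` containing all squares and some `h₀` with `χ₃(h₀) ≠ 1`, every `γ ∈ Γ_F` agrees on `E[3]`
  with an element of `H` (frame `E[3] ≅ 𝔽₃²`, `det ρ̄₃ = χ₃` by the Weil pairing,
  `det_eq_modNCyclotomicCharacter`). Group-theoretic content: the only index-`2` subgroup of
  `GL₂(ℤ/3ⁿℤ)` is `{det ≡ 1 (mod 3)}·⟨-⟩ = ker(Legendre ∘ det)`, so the only quadratic subfield of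
  `ℚ(E[3ⁿ])` is `ℚ(√-3)` when `ρ̄_{E,3ⁿ}` is onto (Serre 1972 §5.3 for the level-`p` statement).
BSD is not proved by any of this.

## References
* [Serre1972] J.-P. Serre, Invent. Math. 15 (1972), §4.2–§5.3 (images in `GL₂(𝔽_p)`, `det = χ_p`).
* [SerreAbelianLadic1968] J.-P. Serre, *Abelian ℓ-adic representations* (1968), IV-23 Lemma 3, IV-27 Ex. 3.
* [SilvermanAEC2009] J. H. Silverman, *AEC* (2009), III.§7–§8 (`E[m] ≅ (ℤ/m)²`, Weil pairing).
* [Howard2004] B. Howard, Compos. Math. 140 (2004), Thm. B (the hypothesis served).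
-/

noncomputable section

open scoped Classical

set_option linter.dupNamespace false
set_option autoImplicit false

namespace Summit.BirchSwinnertonDyer.BirchSwinnertonDyer.Theorems.ThreeAdicImageOverK

open WeierstrassCurve Field Literature.NumberTheory.EllipticCurves
  Literature.NumberTheory.GaloisRepresentations

universe u

/-! ### §1 Transport: surjectivity over an extension `L/K` from elements of `Gal(K̄/L) ≤ Γ_K` -/

section Transport

variable {K : Type u} [Field K] (W : WeierstrassCurve K) (L : Type u) [Field L] [Algebra K L]
  [Algebra.IsAlgebraic K L]

/-- **Transport of surjectivity to a base change.** Let `L/K` be algebraic, `E/K` a Weierstrass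
curve with `ρ̄_{E,n} : Γ_K → Aut(E[n])` onto, and suppose every `γ ∈ Γ_K` agrees on `E[n] ⊆ E(K̄)`
with the restriction `res δ` of some `δ ∈ Γ_L`. Then `ρ̄_{E_L,n} : Γ_L → Aut(E_L[n])` is onto: an
automorphism of `E_L[n]` is carried to one of `E[n]` by the equivariant isomorphism
`E(K̄) ≃ E_L(L̄)` (`exists_addEquiv_geomPoints_baseChange`), realised by some `γ`, hence by `res δ`.
[cite: SilvermanAEC2009, III.§7 and VIII.§1] -/
theorem hasSurjectiveModNGaloisRep_baseChange_of_forall_exists (n : ℕ)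
    (hsurj : W.HasSurjectiveModNGaloisRep (n : ℤ))
    (hH : ∀ γ : absoluteGaloisGroup K, ∃ δ : absoluteGaloisGroup L,
      ∀ P : geomPoints W, P ∈ geomTorsion W (n : ℤ) → absGaloisRestrict K L δ • P = γ • P) :
    (W.baseChange L).HasSurjectiveModNGaloisRep (n : ℤ) := by
  obtain ⟨T, hT⟩ := W.exists_addEquiv_geomPoints_baseChange L
  -- `T` restricts to the `n`-torsion
  have hmem : ∀ P : geomPoints W,
      P ∈ geomTorsion W (n : ℤ) ↔ T P ∈ geomTorsion (W.baseChange L) (n : ℤ) := by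
    intro P
    rw [AddSubgroup.torsionBy.nsmul_iff, AddSubgroup.torsionBy.nsmul_iff, ← map_nsmul,
      T.map_eq_zero_iff]
  have hmem' : ∀ Q : geomPoints (W.baseChange L),
      Q ∈ geomTorsion (W.baseChange L) (n : ℤ) ↔ T.symm Q ∈ geomTorsion W (n : ℤ) := by
    intro Q
    rw [hmem, T.apply_symm_apply]
  set Tn : geomTorsion W (n : ℤ) ≃+ geomTorsion (W.baseChange L) (n : ℤ) :=
    { toFun := fun P ↦ ⟨T P, (hmem P).mp P.2⟩
      invFun := fun Q ↦ ⟨T.symm Q, (hmem' Q).mp Q.2⟩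
      left_inv := fun P ↦ Subtype.ext (T.symm_apply_apply P)
      right_inv := fun Q ↦ Subtype.ext (T.apply_symm_apply Q)
      map_add' := fun P Q ↦ Subtype.ext (by
        change T ((P : geomPoints W) + Q) = T P + T Q
        exact map_add T (P : geomPoints W) Q) } with hTn
  have hTn_symm_coe : ∀ Q : geomTorsion (W.baseChange L) (n : ℤ),
      ((Tn.symm Q : geomTorsion W (n : ℤ)) : geomPoints W) = T.symm Q := fun _ ↦ rfl
  intro φ
  -- pull the automorphism back to `E[n]` over `K`
  set ψ : geomTorsion (W.baseChange L) (n : ℤ) ≃+ geomTorsion (W.baseChange L) (n : ℤ) :=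
    Multiplicative.toAdd φ with hψ
  set ψ' : geomTorsion W (n : ℤ) ≃+ geomTorsion W (n : ℤ) := (Tn.trans ψ).trans Tn.symm with hψ'
  obtain ⟨γ, hγ⟩ := hsurj (Multiplicative.ofAdd ψ')
  have hγP : ∀ P : geomTorsion W (n : ℤ), γ • P = ψ' P := fun P ↦ by
    rw [← galoisRepTorsion_apply W (n : ℤ) γ P, hγ]
    rfl
  obtain ⟨δ, hδ⟩ := hH γ
  refine ⟨δ, ?_⟩
  apply Multiplicative.toAdd.injective
  refine AddEquiv.ext fun Q ↦ Subtype.ext ?_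
  change ((galoisRepTorsion (W.baseChange L) (n : ℤ) δ).toAdd Q : geomPoints (W.baseChange L)) =
    (ψ Q : geomPoints (W.baseChange L))
  rw [galoisRepTorsion_apply, AddSubgroup.torsionBy.coe_smul]
  -- `Q = T P` with `P = T⁻¹ Q ∈ E[n]`
  set P : geomTorsion W (n : ℤ) := Tn.symm Q with hP
  have hQ : (Q : geomPoints (W.baseChange L)) = T (P : geomPoints W) := by
    rw [hP]; exact (T.apply_symm_apply Q).symm
  rw [hQ, ← hT δ P, hδ (P : geomPoints W) P.2]
  have h1 : γ • (P : geomPoints W) = ((ψ' P : geomTorsion W (n : ℤ)) : geomPoints W) := by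
    rw [← AddSubgroup.torsionBy.coe_smul, hγP P]
  rw [h1, hψ', AddEquiv.trans_apply, AddEquiv.trans_apply, hP, AddEquiv.apply_symm_apply,
    hTn_symm_coe, T.apply_symm_apply]

end Transport

/-! ### §2 The elementary tower lemma: `σ ≡ 1` on `E[p]` ⟹ `σ^{p^k} ≡ 1` on `E[p^{k+1}]` -/

section Tower

variable {F : Type u} [Field F] (W : WeierstrassCurve F)

/-- **Tower lemma, one step.** If `σ ∈ Γ_F` fixes `E[m]` pointwise and `p ∣ m`, then `σ^p` fixes
`E[pm]` pointwise: for `P ∈ E[pm]`, `pP ∈ E[m]` is fixed, so `R = σP - P` is killed by `p`, lies in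
`E[p] ⊆ E[m]`, is fixed by `σ`, and `σ^j P = P + jR`, whence `σ^p P = P + pR = P`.
[cite: SerreAbelianLadic1968, IV-23, proof of Lemma 3 (the congruence filtration)] -/
theorem pow_smul_eq_self_of_smul_eq_self (p m : ℕ) (hpm : p ∣ m) (σ : absoluteGaloisGroup F)
    (hσ : ∀ P : geomPoints W, P ∈ geomTorsion W (m : ℤ) → σ • P = P) :
    ∀ P : geomPoints W, P ∈ geomTorsion W ((p * m : ℕ) : ℤ) → σ ^ p • P = P := by
  intro P hP
  -- `p • P ∈ E[m]`, so `σ` fixes it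
  have hpP : p • P ∈ geomTorsion W (m : ℤ) := by
    rw [AddSubgroup.torsionBy.nsmul_iff, ← mul_nsmul]
    exact AddSubgroup.torsionBy.nsmul_iff.mp hP
  -- `R = σP - P` is `p`-torsion, hence `m`-torsion, hence fixed by `σ`
  set R : geomPoints W := σ • P - P with hR
  have hRp : p • R = 0 := by
    rw [hR, smul_sub, ← smul_comm, hσ _ hpP, sub_self]
  have hRm : R ∈ geomTorsion W (m : ℤ) := by
    obtain ⟨c, rfl⟩ := hpm
    rw [AddSubgroup.torsionBy.nsmul_iff]
    rw [mul_nsmul, hRp, smul_zero]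
  have hσR : σ • R = R := hσ R hRm
  -- `σ^j P = P + j • R`
  have hiter : ∀ j : ℕ, σ ^ j • P = P + j • R := by
    intro j
    induction j with
    | zero => rw [pow_zero, one_smul, zero_smul, add_zero]
    | succ j ih =>
      rw [pow_succ', mul_smul, ih, smul_add, ← smul_comm, hσR, succ_nsmul, hR]
      abel
  rw [hiter p, hRp, add_zero]

/-- **Tower lemma.** If `σ ∈ Γ_F` fixes `E[p]` pointwise then `σ^{p^k}` fixes `E[p^{k+1}]`
pointwise, for every `k` (iterate `pow_smul_eq_self_of_smul_eq_self`): on points, the kernel of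
`Aut(E[p^{k+1}]) → Aut(E[p])` is a `p`-group. [cite: SerreAbelianLadic1968, IV-23, proof of Lemma 3] -/
theorem pow_pow_smul_eq_self_of_smul_eq_self (p : ℕ) (σ : absoluteGaloisGroup F)
    (hσ : ∀ P : geomPoints W, P ∈ geomTorsion W (p : ℤ) → σ • P = P) (k : ℕ) :
    ∀ P : geomPoints W, P ∈ geomTorsion W ((p ^ (k + 1) : ℕ) : ℤ) → σ ^ (p ^ k) • P = P := by
  induction k with
  | zero =>
    intro P hP
    rw [pow_zero, pow_one]
    rw [zero_add, pow_one] at hP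
    exact hσ P hP
  | succ k ih =>
    intro P hP
    have h := pow_smul_eq_self_of_smul_eq_self W p (p ^ (k + 1)) (dvd_pow_self p (Nat.succ_ne_zero k))
      (σ ^ (p ^ k)) ih P (by rw [← pow_succ']; exact hP)
    rwa [← pow_mul, ← pow_succ] at h

end Tower

/-! ### §3 Index-two assembly: from level `p` to level `p^n` inside a subgroup containing all squares -/

section IndexTwo

variable {F : Type u} [Field F] (W : WeierstrassCurve F)

/-- **Index-two assembly along the `p`-power tower (`p` odd).** Let `H ≤ Γ_F` contain every square
(e.g. `[Γ_F : H] = 2`) and suppose every `γ ∈ Γ_F` agrees on `E[p]` with some element of `H`. Then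
every `γ` agrees on `E[pⁿ]` with some element of `H`, for every `n`: write `γ = h₁ν` with `ν ≡ 1` on
`E[p]`; by the tower lemma `ν^{p^{n-1}} ≡ 1` on `E[pⁿ]`, and `p^{n-1} = 2m + 1` is odd, so on
`E[pⁿ]` `ν ≡ (ν^m ν^m)⁻¹`, a square. [cite: SerreAbelianLadic1968, IV-23, Lemma 3 and IV-27, Ex. 3] -/
theorem forall_exists_mem_smul_eq_pow (p : ℕ) (hp : Odd p) (H : Subgroup (absoluteGaloisGroup F))
    (hH : ∀ g : absoluteGaloisGroup F, g * g ∈ H)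
    (h1 : ∀ γ : absoluteGaloisGroup F, ∃ h ∈ H,
      ∀ P : geomPoints W, P ∈ geomTorsion W (p : ℤ) → h • P = γ • P) (n : ℕ) :
    ∀ γ : absoluteGaloisGroup F, ∃ h ∈ H,
      ∀ P : geomPoints W, P ∈ geomTorsion W ((p ^ n : ℕ) : ℤ) → h • P = γ • P := by
  intro γ
  cases n with
  | zero =>
    refine ⟨1, by rw [← one_mul (1 : absoluteGaloisGroup F)]; exact hH 1, fun P hP ↦ ?_⟩
    have hP0 : P = 0 := by
      rw [pow_zero, AddSubgroup.torsionBy.nsmul_iff, one_nsmul] at hP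
      exact hP
    rw [hP0, smul_zero, smul_zero]
  | succ k =>
    obtain ⟨h₁, hh₁, hh₁P⟩ := h1 γ
    -- `ν = h₁⁻¹ γ` fixes `E[p]`
    set ν : absoluteGaloisGroup F := h₁⁻¹ * γ with hν
    have hνP : ∀ P : geomPoints W, P ∈ geomTorsion W (p : ℤ) → ν • P = P := by
      intro P hP
      rw [hν, mul_smul, ← hh₁P P hP, inv_smul_smul]
    -- `ν^{p^k}` fixes `E[p^{k+1}]`, and `p^k = 2m + 1`
    have hfix := pow_pow_smul_eq_self_of_smul_eq_self W p ν hνP k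
    obtain ⟨m, hm⟩ := hp.pow (n := k)
    set w : absoluteGaloisGroup F := ν ^ m * ν ^ m with hw
    have hwH : w ∈ H := hH (ν ^ m)
    have hwν : w * ν = ν ^ (p ^ k) := by
      rw [hm, hw, pow_succ, ← pow_add, two_mul]
    refine ⟨h₁ * w⁻¹, H.mul_mem hh₁ (H.inv_mem hwH), fun P hP ↦ ?_⟩
    have h2 : w⁻¹ • P = ν • P := by
      rw [inv_smul_eq_iff, ← mul_smul, hwν, hfix P hP]
    rw [mul_smul, h2, ← mul_smul, hν, mul_inv_cancel_left]

end IndexTwo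

/-! ### §4 Level `3`: a subgroup of `GL₂(𝔽₃)` containing all squares and a matrix of determinant `-1` is everything -/

section LevelThree

open Matrix

variable {M : Subgroup (GL (Fin 2) (ZMod 3))}

/-- Matrices realised in `M` are closed under products. [folklore] -/
private theorem memMat_mul {A B : Matrix (Fin 2) (Fin 2) (ZMod 3)}
    (hA : ∃ g ∈ M, (g : Matrix (Fin 2) (Fin 2) (ZMod 3)) = A)
    (hB : ∃ g ∈ M, (g : Matrix (Fin 2) (Fin 2) (ZMod 3)) = B) :
    ∃ g ∈ M, (g : Matrix (Fin 2) (Fin 2) (ZMod 3)) = A * B := by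
  obtain ⟨g, hg, rfl⟩ := hA
  obtain ⟨h, hh, rfl⟩ := hB
  exact ⟨g * h, M.mul_mem hg hh, by rw [Units.val_mul]⟩

/-- The square of any invertible matrix lies in `M`. [folklore] -/
private theorem memMat_sq (hsq : ∀ g : GL (Fin 2) (ZMod 3), g * g ∈ M)
    (A : Matrix (Fin 2) (Fin 2) (ZMod 3)) (hA : A.det ≠ 0) :
    ∃ g ∈ M, (g : Matrix (Fin 2) (Fin 2) (ZMod 3)) = A * A :=
  ⟨_, hsq (Matrix.GeneralLinearGroup.mkOfDetNeZero A hA), by rw [Units.val_mul]; rfl⟩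

/-- A matrix written as a square of an invertible matrix lies in `M`. [folklore] -/
private theorem memMat_of_eq_sq (hsq : ∀ g : GL (Fin 2) (ZMod 3), g * g ∈ M)
    {A B : Matrix (Fin 2) (Fin 2) (ZMod 3)} (hB : B.det ≠ 0) (hAB : A = B * B) :
    ∃ g ∈ M, (g : Matrix (Fin 2) (Fin 2) (ZMod 3)) = A := by
  rw [hAB]; exact memMat_sq hsq B hB

/-- `(1 x; 0 1) = (1 2x; 0 1)²` lies in `M`. [folklore] -/
private theorem memMat_upper (hsq : ∀ g : GL (Fin 2) (ZMod 3), g * g ∈ M) (x : ZMod 3) :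
    ∃ g ∈ M, (g : Matrix (Fin 2) (Fin 2) (ZMod 3)) = !![1, x; 0, 1] := by
  fin_cases x
  · exact memMat_of_eq_sq hsq (B := !![1, 0; 0, 1]) (by decide) (by decide)
  · exact memMat_of_eq_sq hsq (B := !![1, 2; 0, 1]) (by decide) (by decide)
  · exact memMat_of_eq_sq hsq (B := !![1, 1; 0, 1]) (by decide) (by decide)

/-- `(1 0; c 1) = (1 0; 2c 1)²` lies in `M`. [folklore] -/
private theorem memMat_lower (hsq : ∀ g : GL (Fin 2) (ZMod 3), g * g ∈ M) (c : ZMod 3) :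
    ∃ g ∈ M, (g : Matrix (Fin 2) (Fin 2) (ZMod 3)) = !![1, 0; c, 1] := by
  fin_cases c
  · exact memMat_of_eq_sq hsq (B := !![1, 0; 0, 1]) (by decide) (by decide)
  · exact memMat_of_eq_sq hsq (B := !![1, 0; 2, 1]) (by decide) (by decide)
  · exact memMat_of_eq_sq hsq (B := !![1, 0; 1, 1]) (by decide) (by decide)

/-- Every matrix `(a b; c d)` of determinant `1` over `𝔽₃` lies in `M`: for `c ≠ 0` it is
`U · L · U` (`LevelNine.sl_two_factor_of_ne_zero`), for `c = 0` it is `(1 b; 0 1)` or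
`(2 b; 0 2) = (0 1; 2 0)² · (1 2b; 0 1)`. [folklore] -/
private theorem memMat_fin_two (hsq : ∀ g : GL (Fin 2) (ZMod 3), g * g ∈ M) (a b c d : ZMod 3)
    (hA : a * d - b * c = 1) :
    ∃ g ∈ M, (g : Matrix (Fin 2) (Fin 2) (ZMod 3)) = !![a, b; c, d] := by
  by_cases hc : c = 0
  · subst hc
    have hneg : ∃ g ∈ M, (g : Matrix (Fin 2) (Fin 2) (ZMod 3)) = !![2, 0; 0, 2] :=
      memMat_of_eq_sq hsq (B := !![0, 1; 2, 0]) (by decide) (by decide)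
    have hcases : ∀ a d b : ZMod 3, a * d - b * 0 = 1 → (a = 1 ∧ d = 1) ∨ (a = 2 ∧ d = 2) := by
      decide
    have hprod : ∀ b : ZMod 3, !![2, 0; 0, 2] * !![1, 2 * b; 0, 1] = !![2, b; 0, 2] := by decide
    rcases hcases a d b hA with ⟨rfl, rfl⟩ | ⟨rfl, rfl⟩
    · exact memMat_upper hsq b
    · rw [← hprod b]
      exact memMat_mul hneg (memMat_upper hsq (2 * b))
  · rw [LevelNine.sl_two_factor_of_ne_zero a b c d hA hc]
    exact memMat_mul (memMat_mul (memMat_upper hsq _) (memMat_lower hsq c)) (memMat_upper hsq _)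

/-- Every matrix of determinant `1` over `𝔽₃` lies in `M`. [folklore] -/
private theorem memMat_of_det_eq_one (hsq : ∀ g : GL (Fin 2) (ZMod 3), g * g ∈ M)
    (A : Matrix (Fin 2) (Fin 2) (ZMod 3)) (hA : A.det = 1) :
    ∃ g ∈ M, (g : Matrix (Fin 2) (Fin 2) (ZMod 3)) = A := by
  rw [Matrix.eta_fin_two A] at hA ⊢
  rw [Matrix.det_fin_two_of] at hA
  exact memMat_fin_two hsq _ _ _ _ hA

/-- In `(ℤ/3ℤ)ˣ = {±1}` two elements `≠ 1` multiply to `1`. [folklore] -/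
private theorem units_zmod_three_mul_eq_one {u v : (ZMod 3)ˣ} (hu : u ≠ 1) (hv : v ≠ 1) : u * v = 1 := by
  have key : ∀ z : ZMod 3, z ≠ 0 → z ≠ 1 → z = 2 := by decide
  have hu2 : (u : ZMod 3) = 2 := key _ u.ne_zero (fun h ↦ hu (Units.ext h))
  have hv2 : (v : ZMod 3) = 2 := key _ v.ne_zero (fun h ↦ hv (Units.ext h))
  exact Units.ext (by rw [Units.val_mul, hu2, hv2]; decide)

/-- **A subgroup of `GL₂(𝔽₃)` containing every square and one element of determinant `≠ 1` is all of
`GL₂(𝔽₃)`**: the squares give `SL₂(𝔽₃)` (the transvections `u = (u²)²`, `l`, and `-1 = w²` generate it),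
and `[GL₂(𝔽₃) : SL₂(𝔽₃)] = 2`. [folklore] -/
theorem generalLinearGroup_three_eq_top_of_sq_mem (M : Subgroup (GL (Fin 2) (ZMod 3)))
    (hsq : ∀ g : GL (Fin 2) (ZMod 3), g * g ∈ M)
    (hdet : ∃ g ∈ M, Matrix.GeneralLinearGroup.det g ≠ 1) : M = ⊤ := by
  -- determinant-one elements lie in `M`
  have hSL : ∀ g : GL (Fin 2) (ZMod 3), Matrix.GeneralLinearGroup.det g = 1 → g ∈ M := by
    intro g hg
    have hg' : (g : Matrix (Fin 2) (Fin 2) (ZMod 3)).det = 1 := by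
      rw [← Matrix.GeneralLinearGroup.val_det_apply, hg, Units.val_one]
    obtain ⟨g', hg'M, hgg'⟩ := memMat_of_det_eq_one hsq _ hg'
    rwa [← Units.ext hgg']
  obtain ⟨m₀, hm₀, hm₀det⟩ := hdet
  refine eq_top_iff.mpr fun g _ ↦ ?_
  by_cases hg : Matrix.GeneralLinearGroup.det g = 1
  · exact hSL g hg
  · have h1 : g * m₀ ∈ M := hSL (g * m₀) (by rw [map_mul]; exact units_zmod_three_mul_eq_one hg hm₀det)
    simpa using M.mul_mem h1 (M.inv_mem hm₀)

/-- **Level `3` over a general field.** Let `E/F` be an elliptic curve over a perfect field with `3 ≠ 0`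
and `ρ̄_{E,3} : Γ_F → Aut(E[3])` onto, and let `H ≤ Γ_F` contain every square (e.g. a subgroup of index
`2`) and some `h₀` with `χ₃(h₀) ≠ 1`. Then `H` acts on `E[3]` through ALL of `Aut(E[3])`: every
`γ ∈ Γ_F` agrees on `E[3]` with some `h ∈ H`. (Frame `E[3] ≅ 𝔽₃²`; the image of `H` in `GL₂(𝔽₃)`
contains all squares and `ρ̄(h₀)` of determinant `χ₃(h₀) = -1` by the Weil pairing, so it is
`GL₂(𝔽₃)` by `generalLinearGroup_three_eq_top_of_sq_mem`.) [folklore] -/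
theorem forall_exists_mem_smul_eq_three {F : Type u} [Field F] [PerfectField F]
    [NeZero ((3 : ℕ) : F)] (W : WeierstrassCurve F) [W.IsElliptic]
    (hsurj : W.HasSurjectiveModNGaloisRep 3) (H : Subgroup (absoluteGaloisGroup F))
    (hH : ∀ g : absoluteGaloisGroup F, g * g ∈ H)
    (h₀ : ∃ h ∈ H, modNCyclotomicCharacter F 3 h ≠ 1) :
    ∀ γ : absoluteGaloisGroup F, ∃ h ∈ H,
      ∀ P : geomPoints W, P ∈ geomTorsion W (3 : ℤ) → h • P = γ • P := by
  haveI : Fact (Nat.Prime 3) := ⟨Nat.prime_three⟩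
  have h3 : ((3 : ℕ) : F) ≠ 0 := NeZero.ne _
  obtain ⟨e⟩ := nonempty_addEquiv_geomTorsion W 3 1 le_rfl h3
  obtain ⟨ρ, hρ⟩ := exists_rep_of_addEquiv W e
  have hρs : Function.Surjective ρ := rep_surjective_of_hasSurjectiveModNGaloisRep W e ρ hρ hsurj
  set M : Subgroup (GL (Fin 2) (ZMod 3)) := H.map ρ with hM
  have hsq : ∀ g : GL (Fin 2) (ZMod 3), g * g ∈ M := by
    intro g
    obtain ⟨γ, rfl⟩ := hρs g
    exact ⟨γ * γ, hH γ, map_mul ρ γ γ⟩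
  have hdet : ∃ g ∈ M, Matrix.GeneralLinearGroup.det g ≠ 1 := by
    obtain ⟨h, hh, hχ⟩ := h₀
    refine ⟨ρ h, ⟨h, hh, rfl⟩, fun h1 ↦ hχ (Units.ext ?_)⟩
    have hd := det_eq_modNCyclotomicCharacter W 3 (by norm_num) e h _ (hρ h)
    rw [← hd, ← Matrix.GeneralLinearGroup.val_det_apply, h1]
  have htop : M = ⊤ := generalLinearGroup_three_eq_top_of_sq_mem M hsq hdet
  intro γ
  obtain ⟨h, hh, hhγ⟩ : ρ γ ∈ M := htop ▸ Subgroup.mem_top _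
  refine ⟨h, hh, fun P hP ↦ ?_⟩
  have key : h • (⟨P, hP⟩ : geomTorsion W (3 : ℤ)) = γ • ⟨P, hP⟩ :=
    e.injective (by rw [hρ, hρ, hhγ])
  exact congrArg Subtype.val key

end LevelThree

end Summit.BirchSwinnertonDyer.BirchSwinnertonDyer.Theorems.ThreeAdicImageOverK

end
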